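/-
HONEST FRAMING: certified error envelopes and provably optimal rounding/accumulation schemes for
low-precision formats under stated cost models; every table by two implementations; no hardware
or vendor claims.
-/
import Summits.Ventures.CertifiedArithmetic.LowPrec.OptDemotionBudget

/-!
# The demotion law (Theorem T8), part 7a′: the relaxation TABLE `Φ*` (evaluator, unfolding lemmas, definitions)

Continuation of part 7a (`OptDemotionBudget`): the candidate list `cands q` (left-child grid values
of depth `≤ q+1`), the node evaluator `candMax`/`nodeEntry` (left child enumerated, right child :=
`bmax`, plus the `a = 0` term), the per-shape table `phiTab q s` over the `2^(q-1)` budget mantissas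
of one binade, `phi`/`phiVal` with their unfolding / bounding / nonnegativity lemmas, and the
remaining DEFINITIONS of the development (`mant`, `rlo`, `budgetCheck`, `shapeTab`/`shapesN`/
`shapesUpTo`) so that parts 7b (monotonicity), 7b′ (`exact ≤ Φ*`), 7c (the certificate theorem and
completeness of the shape enumeration) and 7d (kernel certificates) are theorem-only.
-/

namespace Summit.Ventures.CertifiedArithmetic.LowPrec.Opt

open Literature.ComputerArithmetic.JeannerodRump2018
open Literature.ComputerArithmetic.JeannerodRump2018.SumTree

/-! ## The candidate list and the node evaluator -/

/-- All left-child candidates: grid values `(2^(q-1) + i, ja)`, `ja ≤ q + 1`, `i < 2^(q-1)`. -/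
def cands (q : ℕ) : List (ℕ × ℕ) :=
  (List.range (q + 2)).flatMap fun ja => (List.range (2 ^ (q - 1))).map fun i => (2 ^ (q - 1) + i, ja)

/-- Membership in the candidate list. -/
theorem mem_cands {q ma ja : ℕ} (hma : 2 ^ (q - 1) ≤ ma) (hma' : ma < 2 ^ q) (hja : ja ≤ q + 1)
    (hq : 1 ≤ q) : (ma, ja) ∈ cands q := by
  simp only [cands, List.mem_flatMap, List.mem_range, List.mem_map]
  refine ⟨ja, by omega, ma - 2 ^ (q - 1), ?_, ?_⟩
  · have : 2 ^ q = 2 ^ (q - 1) + 2 ^ (q - 1) := by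
      obtain ⟨e, he⟩ : ∃ e, q = e + 1 := ⟨q - 1, by omega⟩
      rw [he, Nat.add_sub_cancel, pow_succ]; ring
    omega
  · ext <;> simp; omega

/-- Members of the candidate list are grid values of depth `≤ q + 1`. -/
theorem cands_bounds {q : ℕ} (hq : 1 ≤ q) {c : ℕ × ℕ} (hc : c ∈ cands q) :
    2 ^ (q - 1) ≤ c.1 ∧ c.1 < 2 ^ q ∧ c.2 ≤ q + 1 := by
  simp only [cands, List.mem_flatMap, List.mem_range, List.mem_map] at hc
  obtain ⟨ja, hja, i, hi, rfl⟩ := hc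
  have : 2 ^ q = 2 ^ (q - 1) + 2 ^ (q - 1) := by
    obtain ⟨e, he⟩ : ∃ e, q = e + 1 := ⟨q - 1, by omega⟩
    rw [he, Nat.add_sub_cancel, pow_succ]; ring
  exact ⟨by simp, by simp; omega, by simp; omega⟩

/-- Read a grid value `(n, k)` from a binade table `T` (entry `i ↦` mantissa `2^(q-1) + i`). -/
def gval (q : ℕ) (T : List ℚ) (n k : ℕ) : ℚ := T.getD (n - 2 ^ (q - 1)) 0 / 2 ^ k

/-- The value of the left candidate `c` for budget `m`: `gval L c + gval R (bmax …)`. -/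
def candTerm (q : ℕ) (L R : List ℚ) (m : ℕ) (c : ℕ × ℕ) : ℚ :=
  gval q L c.1 c.2 + gval q R (bmax q m (c.1 * 2 ^ (q + 1 - c.2))).1 (bmax q m (c.1 * 2 ^ (q + 1 - c.2))).2

/-- A candidate is admissible for budget `m` iff `a ≤ m`, i.e. `A ≤ m·2^(q+1)` (a `Bool`). -/
def candOK (q m : ℕ) (c : ℕ × ℕ) : Bool := decide (c.1 * 2 ^ (q + 1 - c.2) ≤ m * 2 ^ (q + 1))

/-- `candOK` unfolded. -/
theorem candOK_iff {q m : ℕ} {c : ℕ × ℕ} :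
    candOK q m c = true ↔ c.1 * 2 ^ (q + 1 - c.2) ≤ m * 2 ^ (q + 1) := by
  simp [candOK]

/-- The maximum over the admissible candidates of a list, starting from the `a = 0` term
`gval R m 0`. -/
def candMax (q : ℕ) (L R : List ℚ) (m : ℕ) : List (ℕ × ℕ) → ℚ
  | [] => gval q R m 0
  | c :: cs => if candOK q m c then max (candMax q L R m cs) (candTerm q L R m c) else candMax q L R m cs

/-- The node evaluator: `Φ*_(l·r)(m)` from the children's tables. -/
def nodeEntry (q : ℕ) (L R : List ℚ) (m : ℕ) : ℚ := candMax q L R m (cands q)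

/-- The `a = 0` term is below the maximum. -/
theorem init_le_candMax (q : ℕ) (L R : List ℚ) (m : ℕ) :
    ∀ cs : List (ℕ × ℕ), gval q R m 0 ≤ candMax q L R m cs
  | [] => le_rfl
  | c :: cs => by
      unfold candMax
      split_ifs
      · exact (init_le_candMax q L R m cs).trans (le_max_left _ _)
      · exact init_le_candMax q L R m cs

/-- Every admissible candidate's term is below the maximum. -/
theorem term_le_candMax (q : ℕ) (L R : List ℚ) (m : ℕ) :
    ∀ cs : List (ℕ × ℕ), ∀ c ∈ cs, candOK q m c = true → candTerm q L R m c ≤ candMax q L R m cs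
  | [], c, hc, _ => by simp at hc
  | c' :: cs, c, hc, hok => by
      unfold candMax
      rcases List.mem_cons.mp hc with rfl | hc
      · rw [if_pos hok]; exact le_max_right _ _
      · split_ifs
        · exact (term_le_candMax q L R m cs c hc hok).trans (le_max_left _ _)
        · exact term_le_candMax q L R m cs c hc hok

/-- The maximum is below any bound of the `a = 0` term and of all admissible terms. -/
theorem candMax_le (q : ℕ) (L R : List ℚ) (m : ℕ) {B : ℚ} (h0 : gval q R m 0 ≤ B) :
    ∀ cs : List (ℕ × ℕ), (∀ c ∈ cs, candOK q m c = true → candTerm q L R m c ≤ B) → candMax q L R m cs ≤ B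
  | [], _ => h0
  | c :: cs, h => by
      unfold candMax
      split_ifs with hok
      · exact max_le (candMax_le q L R m h0 cs fun c' hc' => h c' (List.mem_cons_of_mem _ hc'))
          (h c List.mem_cons_self hok)
      · exact candMax_le q L R m h0 cs fun c' hc' => h c' (List.mem_cons_of_mem _ hc')

/-! ## The table `Φ*` -/

/-- THE RELAXATION TABLE of a shape at precision `q`: entry `i ↦ Φ*_s(2^(q-1) + i)`. -/
def phiTab (q : ℕ) : Shape → List ℚ
  | .lf => (List.range (2 ^ (q - 1))).map fun i => ((2 ^ (q - 1) + i : ℕ) : ℚ)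
  | .nd a b =>
      let L := phiTab q a
      let R := phiTab q b
      (List.range (2 ^ (q - 1))).map fun i => nodeEntry q L R (2 ^ (q - 1) + i)

/-- `Φ*_s(m)` for a budget mantissa `m ∈ [2^(q-1), 2^q)` (`0` outside). -/
def phi (q : ℕ) (s : Shape) (m : ℕ) : ℚ := (phiTab q s).getD (m - 2 ^ (q - 1)) 0

/-- `Φ*_s` at the grid value `n / 2^k` (scale freeness: `Φ*(c/2^k) = Φ*(c)/2^k`). -/
def phiVal (q : ℕ) (s : Shape) (n k : ℕ) : ℚ := phi q s n / 2 ^ k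

/-- Reading the table of a shape IS `phiVal`. -/
theorem gval_phiTab (q : ℕ) (s : Shape) (n k : ℕ) : gval q (phiTab q s) n k = phiVal q s n k := rfl

/-- The tables have one entry per mantissa of the binade. -/
theorem phiTab_length (q : ℕ) : ∀ s : Shape, (phiTab q s).length = 2 ^ (q - 1)
  | .lf => by simp [phiTab]
  | .nd a b => by simp [phiTab]

/-- `2^q = 2^(q-1) + 2^(q-1)` for `q ≥ 1`. -/
theorem two_pow_eq_half_add_half {q : ℕ} (hq : 1 ≤ q) : 2 ^ q = 2 ^ (q - 1) + 2 ^ (q - 1) := by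
  obtain ⟨e, he⟩ : ∃ e, q = e + 1 := ⟨q - 1, by omega⟩
  rw [he, Nat.add_sub_cancel, pow_succ]; ring

/-- Raw unfolding of the leaf table. -/
theorem phi_lf_raw {q m : ℕ} (hi : m - 2 ^ (q - 1) < 2 ^ (q - 1)) :
    phi q .lf m = ((2 ^ (q - 1) + (m - 2 ^ (q - 1)) : ℕ) : ℚ) := by
  simp only [phi, phiTab, List.getD_eq_getElem?_getD, List.getElem?_map, List.getElem?_range hi,
    Option.map_some, Option.getD_some]

/-- Raw unfolding of the node table. -/
theorem phi_nd_raw {q m : ℕ} (hi : m - 2 ^ (q - 1) < 2 ^ (q - 1)) (a b : Shape) :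
    phi q (.nd a b) m = nodeEntry q (phiTab q a) (phiTab q b) (2 ^ (q - 1) + (m - 2 ^ (q - 1))) := by
  simp only [phi, phiTab, List.getD_eq_getElem?_getD, List.getElem?_map, List.getElem?_range hi,
    Option.map_some, Option.getD_some]

/-- Outside the table the default `0` is returned. -/
theorem phi_of_ge {q m : ℕ} (hi : ¬ m - 2 ^ (q - 1) < 2 ^ (q - 1)) (s : Shape) : phi q s m = 0 := by
  simp only [phi, List.getD_eq_getElem?_getD]
  rw [List.getElem?_eq_none_iff.mpr (by rw [phiTab_length]; omega)]
  rfl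

/-- The leaf table: `Φ*_leaf(m) = m`. -/
theorem phi_lf {q m : ℕ} (hm : 2 ^ (q - 1) ≤ m) (hm' : m < 2 ^ q) (hq : 1 ≤ q) :
    phi q .lf m = m := by
  have hH := two_pow_eq_half_add_half hq
  rw [phi_lf_raw (by omega)]; congr 1; omega

/-- The node table: `Φ*_(a·b)(m) = nodeEntry`. -/
theorem phi_nd {q m : ℕ} (hm : 2 ^ (q - 1) ≤ m) (hm' : m < 2 ^ q) (hq : 1 ≤ q) (a b : Shape) :
    phi q (.nd a b) m = nodeEntry q (phiTab q a) (phiTab q b) m := by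
  have hH := two_pow_eq_half_add_half hq
  rw [phi_nd_raw (by omega)]; congr 1; omega

/-- `Φ* ≥ 0`. -/
theorem phi_nonneg (q : ℕ) : ∀ (s : Shape) (m : ℕ), 0 ≤ phi q s m
  | .lf, m => by
      by_cases hi : m - 2 ^ (q - 1) < 2 ^ (q - 1)
      · rw [phi_lf_raw hi]; positivity
      · rw [phi_of_ge hi]
  | .nd a b, m => by
      by_cases hi : m - 2 ^ (q - 1) < 2 ^ (q - 1)
      · rw [phi_nd_raw hi]
        refine le_trans ?_ (init_le_candMax q _ _ _ _)
        rw [gval_phiTab]; unfold phiVal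
        exact div_nonneg (phi_nonneg q b _) (by positivity)
      · rw [phi_of_ge hi]

/-- `phiVal ≥ 0`. -/
theorem phiVal_nonneg (q : ℕ) (s : Shape) (n k : ℕ) : 0 ≤ phiVal q s n k :=
  div_nonneg (phi_nonneg q s n) (by positivity)

/-- `phiVal` is antitone in the depth. -/
theorem phiVal_depth_antitone (q : ℕ) (s : Shape) (n : ℕ) {k k' : ℕ} (h : k ≤ k') :
    phiVal q s n k' ≤ phiVal q s n k :=
  div_pow_le_div_pow_of_le (phi_nonneg q s n) h

/-! ## Definitions used by parts 7b′–7d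

Collected here so that the later parts are theorem-only files: the mantissa `mant`, the adversarial
demoted value `rlo`, the certificate `budgetCheck`, and the shape enumeration `shapesN`. -/

/-- The mantissa of a positive rational at precision `q`: `v = mant · 2^(⌊log₂ v⌋ + 1 - q)` for floats. -/
def mant (q : ℕ) (v : ℚ) : ℕ := (⌊v / (2 : ℚ) ^ (Int.log 2 v + 1 - q)⌋).toNat

/-- The least possible demoted value (in units of the budget scale) of the mantissa `m`. -/
def rlo (q p m : ℕ) : ℕ :=
  if m - m / (2 * 2 ^ (q - 1 - p)) * (2 * 2 ^ (q - 1 - p)) ≤ 2 ^ (q - 1 - p)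
  then m / (2 * 2 ^ (q - 1 - p)) * (2 * 2 ^ (q - 1 - p))
  else m / (2 * 2 ^ (q - 1 - p)) * (2 * 2 ^ (q - 1 - p)) + 2 * 2 ^ (q - 1 - p)

/-- **THE DEMOTION CERTIFICATE** of a shape at `(q, p)`: `Φ*_s(m) ≤ Q_s · rlo(m)` for every budget
mantissa `m ∈ [2^(q-1), 2^q)` (`Q_s = treeQf u_q s u_p`).  Decidable; evaluate with `decide +kernel`. -/
def budgetCheck (q p : ℕ) (s : Shape) : Bool :=
  let T := phiTab q s
  let Q := treeQf (unitRoundoff q) s.toTree (unitRoundoff p)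
  (List.range (2 ^ (q - 1))).all fun i =>
    decide (T.getD i 0 ≤ Q * (rlo q p (2 ^ (q - 1) + i) : ℚ))

/-- Table of shape lists: entry `k` of `shapeTab n` (for `k ≤ n`) is the list of ALL shapes with
exactly `k` leaves (entry `0` is empty). -/
def shapeTab : ℕ → List (List Shape)
  | 0 => [[]]
  | n + 1 =>
      let T := shapeTab n
      T ++ [if n = 0 then [Shape.lf] else
        (List.range (n + 1)).flatMap fun k =>
          (T.getD k []).flatMap fun a => (T.getD (n + 1 - k) []).map fun b => Shape.nd a b]

/-- All shapes with exactly `n` leaves. -/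
def shapesN (n : ℕ) : List Shape := (shapeTab n).getD n []

/-- All shapes with at most `N` leaves. -/
def shapesUpTo (N : ℕ) : List Shape := (List.range (N + 1)).flatMap shapesN

end Summit.Ventures.CertifiedArithmetic.LowPrec.Opt
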